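import Summits.BirchSwinnertonDyer.Rank1Residual.Additive.TwistPartnerForcedDichotomyOfDelbourgo
import Literature.NumberTheory.GaussSums.GaussSumTeichmullerPadicNormProofs
import HarnessLib

/-!
# A CHARACTER-FREE sign certificate for the defect-3/4/6 tame branch: ONE wild twisted symbol sum
# of small `p`-adic valuation decides Delbourgo's character (Stickelberger's theorem for the
# conjugate Gauss sums) (cell `b2b-bsdres`, sub-cell additive-p2 = X3♯(G-ord)/X4♯(G-ord), gen 26)

HONEST FRAMING (cell `b2b-bsdres`, run/shared/lean/b2b/bsd-rank1-residual/, verbatim in every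
file): the goal of the cell is to DELETE the COMBINATION-SHAPED residual classes of the
Birch–Swinnerton-Dyer formula for ALL analytic-rank `≤ 1` elliptic curves over `ℚ` — "full BSD
formula for every rank `≤ 1` curve in class `C`" assembled STRICTLY from published theorems — so
that the rank-`≤ 1` remainder becomes exactly the CONSTRUCTION-SHAPED classes, which are TYPED
(missing-input `Prop`s), NOT attempted. This is not "finishing BSD". Sub-cell additive-p2: the
classes X3♯(G-ord) / X4♯(G-ord) are CONSTRUCTION-SHAPED and stay so; labels / RESIDUAL-MAP marks
UNCHANGED; nothing is booked. Theorems only; the named fact `Delbourgo1998.thm1_exists_bounded_evenMeasure`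
(A282) enters as a hypothesis binder. No definition, no `sorry`.

## What

Gen 25's SIGN CERTIFICATE decides WHICH of the two conjugate characters `χ^{±1}` of order
`e ∈ {3,4,6}` carries the tower-bounded forced partner by exhibiting one tower value of the CONJUGATE
forced partner beyond the plus-symbol bound — it requires the forced partner of `χ⁻¹` (a tower
computation). This file gives a certificate that needs NO forced partner: ONE even wild twisted symbol
sum `S(κ) = Σ_b κ(b)[b/p^m]⁺_f` of SMALL `p`-adic absolute value.

* §1 `norm_le_of_hasSum_coeff_mul_pow` — a power series with coefficients of norm `≤ C` evaluated at
  `‖z‖ ≤ 1` (as a `HasSum` in `ℂ_p`) has value of norm `≤ C`.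
* §2 `IsTameBranchOf.mul_norm_tameGaussSum_mul_norm_le` — for EVERY witness `B` of the package with
  `‖[Tʲ]B‖ ≤ p^c` and `‖α‖ = 1`, and every even primitive wild `κ` of conductor `p^m ≥ p²`:
  `p · ‖τ(ε, ψ_κ)‖ · ‖S(κ)‖ ≤ p^c` (the interpolation row `B(κ(γ)−1) = α^{−m}p⁻¹τ(ε,ψ_κ)S(κ)`).
* §3 **`towerBounded_forced_of_thm1_of_gaussCert`** — setting of gen 25/26 (ADDITIVE, `p ≥ 5`,
  `e ∈ {3,4,6}`, (G)-field `F`, `w ∣ p`, THE unit root `ã`, `χ` of order `e`, plus-symbol tower bound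
  `p^c`): if ONE wild `κ` has `p^c < p · ‖τ(ι∘χ⁻¹, ψ_κ)‖ · ‖S(κ)‖`, then the forced partner of
  `(χ, ã)` IS tower-bounded (Delbourgo 1998 Thm. 1 gives one of `χ^{±1}`; `χ⁻¹` would violate §2).
* §4 **The Gauss sum made explicit by STICKELBERGER** (`Literature.….norm_gaussSum_pow_eq_of_mul_eq'`):
  if `χ⁻¹` is the Teichmüller power of exponent `(e−1)u`, `eu = p − 1` (equivalently `χ = ω^u`, the
  SMALL exponent — the UNSTARRED types II, III, IV, where the census's bounded character `ω^{t(E,p)}`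
  has `t = (p−1)/e`), then `‖τ(ι∘χ⁻¹, ψ_κ)‖^e = p⁻¹` and the certificate reads
  **`p^{ec} < p^{e−1}·‖S(κ)‖^e`, i.e. `ord_p S(κ) < 1 − 1/e − c` ⟹ `(χ, ã)` tower-bounded**
  (`towerBounded_forced_of_thm1_of_norm_ratTwistedSymbolSum`; X4 form with `c = 0`). For the bounded
  branch itself `ord_p S(κ) = ord_p B(κ(γ)−1) + 1/e`, so on unit rows (`λ_an = 1`, `μ_an = 0`) the
  certificate fires already at conductor `p²` (gen 26 E-NONVANISH data: 10450be1@5, `T = (0,−1,1,1,−1)`,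
  `ord_5 S(κ) = 1/2 < 3/4`); on STARRED types (`χ = ω^{(e−1)u}`) the conjugate Gauss sum is the LARGE
  one and this certificate never fires (Stickelberger's asymmetry) — there gen 25's certificate remains.

Not claimed: anything for starred types; which Teichmüller power `χ` is (input `IsTeichmullerPow`-shaped
hypothesis on `χ⁻¹`). Nothing booked.

References: Delbourgo 1998 Thm. 1 [Delbourgo1998]; Lang, *Cyclotomic Fields* I, Ch. 1 §2 Thm. 2.1
(Stickelberger) [Lang1990]; Mazur–Tate–Teitelbaum 1986 §I.8, §I.14 [MazurTateTeitelbaum1986Invent]. -/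

noncomputable section

open scoped Classical MatrixGroups ModularForm NumberField Topology

open CongruenceSubgroup IsDedekindDomain WeierstrassCurve NumberField Filter
  Literature.NumberTheory.EllipticCurves
  Literature.NumberTheory.EllipticCurves.ModularForms
  Literature.NumberTheory.EllipticCurves.Rank1Residual
  Literature.NumberTheory.GaussSums

namespace Summit.BirchSwinnertonDyer.Rank1Residual.Additive

namespace TwistPartner

/-! ### §1 Evaluating a bounded power series inside the unit disc of `ℂ_p` -/

section Eval

variable {p : ℕ} [hp : Fact p.Prime]

/-- **A power series with coefficients of norm `≤ C`, evaluated at `‖z‖ ≤ 1`, has value of norm `≤ C`**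
(`HasSum` form in `ℂ_p`; partial sums are bounded by `C` by the ultrametric inequality and the closed
ball is closed). [folklore] -/
theorem norm_le_of_hasSum_coeff_mul_pow {b : ℕ → ℚ_[p]} {z V : ℂ_[p]} {C : ℝ}
    (hC : ∀ k, ‖b k‖ ≤ C) (hz : ‖z‖ ≤ 1)
    (h : HasSum (fun k ↦ algebraMap ℚ_[p] ℂ_[p] (b k) * z ^ k) V) : ‖V‖ ≤ C := by
  have hC0 : 0 ≤ C := (norm_nonneg _).trans (hC 0)
  have hpart : ∀ n : ℕ, ‖∑ k ∈ Finset.range n, algebraMap ℚ_[p] ℂ_[p] (b k) * z ^ k‖ ≤ C := by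
    intro n
    refine IsUltrametricDist.norm_sum_le_of_forall_le_of_nonneg hC0 fun k _ ↦ ?_
    rw [norm_mul, norm_algebraMap', norm_pow]
    calc ‖b k‖ * ‖z‖ ^ k ≤ C * 1 := by
          gcongr
          · exact hC k
          · exact pow_le_one₀ (norm_nonneg _) hz
      _ = C := mul_one C
  exact le_of_tendsto' (h.tendsto_sum_nat.norm) hpart

end Eval

/-! ### §2 The interpolation row bounds `p·‖τ(ε,ψ_κ)‖·‖S(κ)‖` for every bounded witness -/

section Row

variable {p : ℕ} [hp : Fact p.Prime] {N : ℕ} {f : CuspForm (Gamma0 N) 2}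

/-- **Every witness with coefficient bound `p^c` bounds the wild twisted symbol sums**: for
`IsTameBranchOf f p ε α B` with `‖α‖ = 1`, `‖[Tʲ]B‖ ≤ p^c` for all `j`, and `κ` even primitive of
conductor `p^m`, `m ≥ 2`, of `p`-power order: `p · ‖τ(ε, ψ_κ)‖ · ‖S(κ)‖ ≤ p^c`, where
`S(κ) = Σ_b κ(b)[b/p^m]⁺_f` (the interpolation row `B(κ(γ) − 1) = α^{−m}p⁻¹τ(ε,ψ_κ)S(κ)` evaluated with
`‖κ(γ) − 1‖ < 1`). [cite: MazurTateTeitelbaum1986Invent, §I.8, §I.14 (14.3)] -/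
theorem _root_.Summit.BirchSwinnertonDyer.Rank1Residual.Additive.IsTameBranchOf.mul_norm_tameGaussSum_mul_norm_le
    {ε : DirichletCharacter ℂ_[p] p} {α : ℚ_[p]} {B : PowerSeries ℚ_[p]}
    (h : IsTameBranchOf f p ε α B) (hα : ‖α‖ = 1) {c : ℕ}
    (hbd : ∀ j : ℕ, ‖PowerSeries.coeff j B‖ ≤ (p : ℝ) ^ c)
    {m : ℕ} (hm : 2 ≤ m) {κ : DirichletCharacter ℂ_[p] (p ^ m)} (hκ : κ.IsPrimitive) (heven : κ.Even)
    (hord : ∃ j : ℕ, orderOf κ = p ^ j) :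
    (p : ℝ) * ‖tameGaussSum p ε κ‖ * ‖ratTwistedSymbolSum f κ‖ ≤ (p : ℝ) ^ c := by
  have hsum := h.2.2 m hm κ hκ heven hord
  have hz : ‖κ (cyclotomicGenerator p : ZMod (p ^ m)) - 1‖ ≤ 1 :=
    (norm_apply_cyclotomicGenerator_sub_one_lt κ hord).le
  have hV := norm_le_of_hasSum_coeff_mul_pow hbd hz hsum
  have hp0 : (p : ℚ_[p]) ≠ 0 := Nat.cast_ne_zero.mpr hp.out.ne_zero
  have hconst : ‖algebraMap ℚ_[p] ℂ_[p] (α⁻¹ ^ m * (p : ℚ_[p])⁻¹)‖ = (p : ℝ) := by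
    rw [norm_algebraMap', norm_mul, norm_pow, norm_inv, hα, inv_one, one_pow, one_mul, norm_inv,
      Padic.norm_p, inv_inv]
  rw [norm_mul, norm_mul, hconst] at hV
  exact hV

end Row

/-! ### §3 The character-free sign certificate -/

section Cert

variable {W : WeierstrassCurve ℚ} [W.IsElliptic] [W.IsGloballyMinimal] {p : ℕ} [hp : Fact p.Prime]
  {N : ℕ} [NeZero N] {f : CuspForm (Gamma0 N) 2} {χ : MulChar (ZMod p) ℚ_[p]} {ã : ℚ_[p]}

/-- **CHARACTER-FREE SIGN CERTIFICATE (Delbourgo 1998 Thm. 1 + the interpolation row).** Setting of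
`towerBounded_forced_or_inv_of_thm1` (ADDITIVE, `p ≥ 5`, defect `e ∈ {3,4,6}`, (G)-field `F`, `w ∣ p`,
THE unit root `ã`, `χ` of order `e`), a tower bound `p^c` of the plus symbols, and ONE even primitive
wild `κ` of conductor `p^m ≥ p²` with **`p^c < p · ‖τ(ι∘χ⁻¹, ψ_κ)‖ · ‖Σ_b κ(b)[b/p^m]⁺_f‖`**. Then the
forced partner of `(χ, ã)` is bounded on the tower: by the fact one of `χ^{±1}` has a tower-bounded
partner, and a tower-bounded partner for `χ⁻¹` would give a witness `B'` of `(ι∘χ⁻¹, ã)` with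
coefficients bounded by `p^c`, contradicting `IsTameBranchOf.mul_norm_tameGaussSum_mul_norm_le`. NO
forced partner of `χ⁻¹` is computed. Nothing booked. [cite: Delbourgo1998, Theorem 1 (p. 131), p. 130]
[cite: MazurTateTeitelbaum1986Invent, §I.8, §I.14] -/
theorem towerBounded_forced_of_thm1_of_gaussCert (hD : Delbourgo1998.thm1_exists_bounded_evenMeasure)
    (h5 : 5 ≤ p) (hadd : Addv W p) (he : semistabilityIndex W p ∈ ({3, 4, 6} : Finset ℕ))
    (hf : IsNewformOf W f)
    {L : Type} [Field L] [NumberField L] [IsCyclotomicExtension {p} ℚ L] (F : IntermediateField ℚ L)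
    (hF : ∀ w : HeightOneSpectrum (𝓞 F), (p : 𝓞 F) ∈ w.asIdeal →
      (W.baseChange F).HasGoodReductionAt w ∧ (W.baseChange F).HasUnitRootAt w)
    (w : HeightOneSpectrum (𝓞 F)) (hw : (p : 𝓞 F) ∈ w.asIdeal)
    (hã : ‖ã‖ = 1) (hroot : ã ^ 2 - (((W.baseChange F).frobeniusTraceAt w : ℤ) : ℚ_[p]) * ã + p = 0)
    (hχe : orderOf χ = semistabilityIndex W p) {c : ℕ}
    (hc : ∀ (n : ℕ) (a : ℤ), ‖((ratPlusSymbol f ((a : ℚ) / (p : ℚ) ^ n) : ℚ) : ℚ_[p])‖ ≤ (p : ℝ) ^ c)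
    {m : ℕ} (hm : 2 ≤ m) {κ : DirichletCharacter ℂ_[p] (p ^ m)} (hκ : κ.IsPrimitive) (heven : κ.Even)
    (hord : ∃ j : ℕ, orderOf κ = p ^ j)
    (hcert : (p : ℝ) ^ c <
      (p : ℝ) * ‖tameGaussSum p (χ⁻¹.ringHomComp (algebraMap ℚ_[p] ℂ_[p])) κ‖ *
        ‖ratTwistedSymbolSum f κ‖) :
    ∃ C₀ : ℝ, ∀ (n : ℕ) (a : ℤ),
      ‖forced χ (fun r ↦ ((ratPlusSymbol f r : ℚ) : ℚ_[p])) ã ((a : ℚ) / (p : ℚ) ^ n)‖ ≤ C₀ := by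
  rcases towerBounded_forced_or_inv_of_thm1 hD h5 hadd he hf F hF w hw hã hroot hχe with hbd | ⟨C₁, hC₁⟩
  · exact hbd
  · exfalso
    have hχ : χ⁻¹ ≠ χ := inv_ne_self_of_orderOf_mem he hχe
    have hχ1' : χ⁻¹ ≠ 1 := fun h ↦ hχ (by rw [h]; exact (inv_eq_one.mp h).symm)
    have hU0 := sum_ratPlusSymbol_add_div_eq_zero_of_addv W hf hadd
    obtain ⟨B', hB', hint⟩ := exists_isTameBranchOf_of_towerBounded_forced hχ1' hã hU0 hC₁
    have hle := hB'.mul_norm_tameGaussSum_mul_norm_le hã (hint _ hc) hm hκ heven hord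
    exact (lt_irrefl _) (hcert.trans_le hle)

/-- **The certificate with the Gauss sum evaluated by STICKELBERGER (unstarred case).** In the
setting of `towerBounded_forced_of_thm1_of_gaussCert`, suppose moreover that `χ⁻¹` is the
Teichmüller power of exponent `(e−1)u` with `e·u = p − 1` (`‖χ⁻¹(a) − a^{(e−1)u}‖_p < 1`; i.e.
`χ = ω^u`, the SMALL exponent of order `e` — the unstarred Kodaira types). Then
`‖τ(ι∘χ⁻¹, ψ_κ)‖^e = p⁻¹` (`Literature.….norm_gaussSum_pow_eq_of_mul_eq'`, Lang Ch. 1 §2 Thm. 2.1), so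
ONE even primitive wild `κ` of conductor `p^m ≥ p²` with **`p^{ec} < p^{e−1} · ‖Σ_b κ(b)[b/p^m]⁺_f‖^e`**
(i.e. `ord_p S(κ) < 1 − 1/e − c`) makes the forced partner of `(χ, ã)` tower-bounded — a sign
certificate read off ONE twisted symbol sum, with no forced partner of `χ⁻¹`. Nothing booked.
[cite: Delbourgo1998, Theorem 1 (p. 131)] [cite: Lang1990, Ch. 1 §2 Thm. 2.1]
[cite: MazurTateTeitelbaum1986Invent, §I.8, §I.14] -/
theorem towerBounded_forced_of_thm1_of_norm_ratTwistedSymbolSum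
    (hD : Delbourgo1998.thm1_exists_bounded_evenMeasure)
    (h5 : 5 ≤ p) (hadd : Addv W p) (he : semistabilityIndex W p ∈ ({3, 4, 6} : Finset ℕ))
    (hf : IsNewformOf W f)
    {L : Type} [Field L] [NumberField L] [IsCyclotomicExtension {p} ℚ L] (F : IntermediateField ℚ L)
    (hF : ∀ w : HeightOneSpectrum (𝓞 F), (p : 𝓞 F) ∈ w.asIdeal →
      (W.baseChange F).HasGoodReductionAt w ∧ (W.baseChange F).HasUnitRootAt w)
    (w : HeightOneSpectrum (𝓞 F)) (hw : (p : 𝓞 F) ∈ w.asIdeal)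
    (hã : ‖ã‖ = 1) (hroot : ã ^ 2 - (((W.baseChange F).frobeniusTraceAt w : ℤ) : ℚ_[p]) * ã + p = 0)
    (hχe : orderOf χ = semistabilityIndex W p) {u : ℕ}
    (hu : semistabilityIndex W p * u = p - 1)
    (hteich : ∀ a : ZMod p, a ≠ 0 →
      ‖χ⁻¹ a - ((a.val : ℕ) : ℚ_[p]) ^ ((semistabilityIndex W p - 1) * u)‖ < 1) {c : ℕ}
    (hc : ∀ (n : ℕ) (a : ℤ), ‖((ratPlusSymbol f ((a : ℚ) / (p : ℚ) ^ n) : ℚ) : ℚ_[p])‖ ≤ (p : ℝ) ^ c)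
    {m : ℕ} (hm : 2 ≤ m) {κ : DirichletCharacter ℂ_[p] (p ^ m)} (hκ : κ.IsPrimitive) (heven : κ.Even)
    (hord : ∃ j : ℕ, orderOf κ = p ^ j)
    (hcert : (p : ℝ) ^ (semistabilityIndex W p * c) <
      (p : ℝ) ^ (semistabilityIndex W p - 1) * ‖ratTwistedSymbolSum f κ‖ ^ semistabilityIndex W p) :
    ∃ C₀ : ℝ, ∀ (n : ℕ) (a : ℤ),
      ‖forced χ (fun r ↦ ((ratPlusSymbol f r : ℚ) : ℚ_[p])) ã ((a : ℚ) / (p : ℚ) ^ n)‖ ≤ C₀ := by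
  set e := semistabilityIndex W p with he_def
  have h2 : 2 ≤ e := by
    simp only [Finset.mem_insert, Finset.mem_singleton] at he; omega
  have hχe' : orderOf χ⁻¹ = e := by rw [orderOf_inv, hχe]
  have hp0 : (0 : ℝ) < p := by exact_mod_cast hp.out.pos
  -- Stickelberger: `‖τ(ι∘χ⁻¹, ψ_κ)‖^e = p⁻¹`
  have hG : ‖tameGaussSum p (χ⁻¹.ringHomComp (algebraMap ℚ_[p] ℂ_[p])) κ‖ ^ e = (p : ℝ)⁻¹ := by
    rw [tameGaussSum_eq_gaussSum hm]
    exact norm_gaussSum_pow_eq_of_mul_eq' hteich hχe' h2 hu (isPrimitive_wildAddChar hm hκ)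
  -- compare `e`-th powers
  refine towerBounded_forced_of_thm1_of_gaussCert hD h5 hadd he hf F hF w hw hã hroot hχe hc hm hκ
    heven hord ?_
  set T := ‖tameGaussSum p (χ⁻¹.ringHomComp (algebraMap ℚ_[p] ℂ_[p])) κ‖ with hT
  set S := ‖ratTwistedSymbolSum f κ‖ with hS
  have hT0 : 0 ≤ T := norm_nonneg _
  have hS0 : 0 ≤ S := norm_nonneg _
  by_contra hle
  push Not at hle
  -- `(p·T·S)^e ≤ p^{ec}` contradicts `hcert` since `(p·T·S)^e = p^e · p⁻¹ · S^e = p^{e−1} S^e`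
  have hpow : ((p : ℝ) * T * S) ^ e ≤ ((p : ℝ) ^ c) ^ e :=
    pow_le_pow_left₀ (by positivity) hle e
  have hexp : ((p : ℝ) * T * S) ^ e = (p : ℝ) ^ (e - 1) * S ^ e := by
    rw [mul_pow, mul_pow, hG]
    have : (p : ℝ) ^ e * (p : ℝ)⁻¹ = (p : ℝ) ^ (e - 1) := by
      rw [← pow_sub_one_mul (by omega : e ≠ 0) (p : ℝ)]
      field_simp
    rw [this]
  rw [hexp, ← pow_mul, mul_comm c] at hpow
  exact (lt_irrefl _) (hcert.trans_le hpow)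

/-- **X4♯(G-ord), defect 3, 4, 6, `p ≥ 5` — the character-free sign certificate at the
Drinfeld–Manin bound (`c = 0`)**: for a (G)-field `F`, `w ∣ p`, THE unit root `ã`, a character `χ` of
order `e` whose inverse is the Teichmüller power `ω^{(e−1)u}` (`eu = p − 1`), and ONE even primitive
wild `κ` of conductor `p^m ≥ p²` with **`1 < p^{e−1}·‖Σ_b κ(b)[b/p^m]⁺_f‖_p^e`** (`ord_p S(κ) < 1 − 1/e`):
the forced partner of `(χ, ã)` is tower-bounded (Delbourgo 1998 Thm. 1 + Stickelberger + irreducible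
`E[p]`). Nothing booked; X4♯(G-ord) CONSTRUCTION-SHAPED. [cite: Delbourgo1998, Theorem 1 (p. 131)]
[cite: Lang1990, Ch. 1 §2 Thm. 2.1] [cite: Manin1972, Cor. 3.6] -/
theorem ClassX4Gord.towerBounded_forced_of_thm1_of_norm_ratTwistedSymbolSum
    (hD : Delbourgo1998.thm1_exists_bounded_evenMeasure) (hX : ClassX4Gord W p) (h5 : 5 ≤ p)
    (he : semistabilityIndex W p ∈ ({3, 4, 6} : Finset ℕ)) (hf : IsNewformOf W f)
    {L : Type} [Field L] [NumberField L] [IsCyclotomicExtension {p} ℚ L] (F : IntermediateField ℚ L)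
    (hF : ∀ w : HeightOneSpectrum (𝓞 F), (p : 𝓞 F) ∈ w.asIdeal →
      (W.baseChange F).HasGoodReductionAt w ∧ (W.baseChange F).HasUnitRootAt w)
    (w : HeightOneSpectrum (𝓞 F)) (hw : (p : 𝓞 F) ∈ w.asIdeal)
    (hã : ‖ã‖ = 1) (hroot : ã ^ 2 - (((W.baseChange F).frobeniusTraceAt w : ℤ) : ℚ_[p]) * ã + p = 0)
    (hχe : orderOf χ = semistabilityIndex W p) {u : ℕ}
    (hu : semistabilityIndex W p * u = p - 1)
    (hteich : ∀ a : ZMod p, a ≠ 0 →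
      ‖χ⁻¹ a - ((a.val : ℕ) : ℚ_[p]) ^ ((semistabilityIndex W p - 1) * u)‖ < 1)
    {m : ℕ} (hm : 2 ≤ m) {κ : DirichletCharacter ℂ_[p] (p ^ m)} (hκ : κ.IsPrimitive) (heven : κ.Even)
    (hord : ∃ j : ℕ, orderOf κ = p ^ j)
    (hcert : 1 < (p : ℝ) ^ (semistabilityIndex W p - 1) *
      ‖ratTwistedSymbolSum f κ‖ ^ semistabilityIndex W p) :
    ∃ C₀ : ℝ, ∀ (n : ℕ) (a : ℤ),
      ‖forced χ (fun r ↦ ((ratPlusSymbol f r : ℚ) : ℚ_[p])) ã ((a : ℚ) / (p : ℚ) ^ n)‖ ≤ C₀ := by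
  have hc : ∀ (n : ℕ) (a : ℤ),
      ‖((ratPlusSymbol f ((a : ℚ) / (p : ℚ) ^ n) : ℚ) : ℚ_[p])‖ ≤ (p : ℝ) ^ (0 : ℕ) := fun n a ↦ by
    rw [pow_zero]
    exact plusSymbolsPIntegralAt_of_classX4 W p hX.1 f hf _
  exact TwistPartner.towerBounded_forced_of_thm1_of_norm_ratTwistedSymbolSum hD h5 hX.addv.2 he hf F hF
    w hw hã hroot hχe hu hteich hc hm hκ heven hord (by rw [mul_zero, pow_zero]; exact hcert)

end Cert

end TwistPartner

end Summit.BirchSwinnertonDyer.Rank1Residual.Additive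

end
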